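import Literature.Geometry.Lorentzian.KerrConvergenceProofs
import Literature.Geometry.Lorentzian.CauchyProblemProofs
import Literature.Geometry.Lorentzian.DeviationTolerance
import Literature.Geometry.Lorentzian.ConvergenceTransport
import Literature.Geometry.Lorentzian.CausalityProofs

/-!
# Solo (blind) — eventual time-orientation dichotomy of an asymptotically flat chart

The formal half of gap **F2** of the seat's statement paper (§13.2). Let `Ψ : E4 → M` be a smooth
chart read of a spacetime `(M, g, T)` whose `Cᵏ` deviation from the Minkowski background on the
slabs `{x⁰ = τ}`, `τ ≥ τ₁`, is at most `1/10` (e.g. eventually, under `ConvergesToMinkowski`).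
Then EITHER `dΨ(∂₀)` is future-directed timelike at every chart point with `x⁰ ≥ τ₁`, OR it is
past-directed timelike at every such point (`soloBlind_orientation_dichotomy`); no causality or
connectedness hypothesis on `M` is used. Two late chart points are joined to a common apex by
two straight chart segments with directions `v`, `v⁰ = 1`, `‖v − ∂₀‖ ≤ 1/10`, along which
`dΨ(v)` stays timelike (`|Ψ^*g − η| ≤ 1/10` pointwise), so the continuous nowhere-zero function
`s ↦ g(T, dΨ(v))` keeps its sign, and at the endpoints `dΨ(v)`, `dΨ(∂₀)` share a timecone.
Hence hypothesis (d) of the seat's tied flat chart (`Theorems/SoloBlindDispersal.lean`) reduces,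
given smallness of the deviation from `τ₀` on, to EXCLUDING the past-directed branch (which the
sequel does for Cauchy developments, from the causal tie (c) and the Cauchy property).

References: B. O'Neill, *Semi-Riemannian geometry* (1983), Ch. 5, Lemma 5.26 and p. 145
(timecones); D. Christodoulou, S. Klainerman, *The global nonlinear stability of the Minkowski
space* (1993), Thm. 1.0.2 (the deviation `g − η`); J. M. Lee, *Introduction to Smooth
Manifolds* (2013), Prop. 3.9 (open submanifolds).
-/

noncomputable section

open Literature.Geometry.Lorentzian TopologicalSpace Manifold Filter Topology Set Function
open scoped ContDiff Topology ENNReal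

namespace Summit.FinalStateConjecture.FinalStateConjecture.Theorems

variable {𝓢 : Spacetime.{0} 4}

/-! ### Straight chart segments and their velocities -/

/-- The image under the chart read `Ψ` of the straight chart line `s ↦ x + s v`. -/
def soloBlindLineCurve (Ψ : Minkowski.background.domain → 𝓢.carrier) (x v : E4) (s : ℝ) :
    𝓢.carrier :=
  Ψ ⟨x + s • v, trivial⟩

/-- **Velocity of a chart line**: for a smooth `Ψ`, `s ↦ Ψ(x + s v)` is differentiable with
velocity `dΨ_{x + s v}(v)` (chain rule through the open submanifold `⊤ ⊆ E4`, Lee 2013,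
Prop. 3.9; O'Neill 1983, Ch. 3, Ex. 3.25). -/
theorem soloBlind_velocity_lineCurve {Ψ : Minkowski.background.domain → 𝓢.carrier}
    (hΨ : ContMDiff 𝓘(ℝ, E4) (𝓡 4) ∞ Ψ) (x v : E4) (s : ℝ) :
    MDifferentiableAt 𝓘(ℝ, ℝ) (𝓡 4) (soloBlindLineCurve Ψ x v) s ∧
      velocity (𝓡 4) (soloBlindLineCurve Ψ x v) s =
        mfderiv 𝓘(ℝ, E4) (𝓡 4) Ψ ⟨x + s • v, trivial⟩ v := by
  have hΦd : ∀ y : E4, MDifferentiableAt 𝓘(ℝ, E4) (𝓡 4) (fun y : E4 ↦ Ψ ⟨y, trivial⟩) y :=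
    fun y ↦ (mdifferentiableAt_comp_subtypeVal_iff (W := Minkowski.background.domain)
      (f := fun y : E4 ↦ Ψ ⟨y, trivial⟩) (y := ⟨y, trivial⟩)).mp (hΨ.mdifferentiableAt (by simp))
  have hℓd : HasDerivAt (fun s : ℝ ↦ x + s • v) v s := by
    have h := ((hasDerivAt_id' s).smul_const v).const_add x
    rwa [one_smul] at h
  have hℓm : MDifferentiableAt 𝓘(ℝ, ℝ) 𝓘(ℝ, E4) (fun s : ℝ ↦ x + s • v) s :=
    mdifferentiableAt_iff_differentiableAt.mpr hℓd.differentiableAt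
  have hvel : mfderiv 𝓘(ℝ, ℝ) 𝓘(ℝ, E4) (fun s : ℝ ↦ x + s • v) s 1 = v :=
    ModelSpace.velocity_line x v s
  have hcurve : soloBlindLineCurve Ψ x v =
      (fun y : E4 ↦ Ψ ⟨y, trivial⟩) ∘ fun s : ℝ ↦ x + s • v := rfl
  rw [hcurve]
  refine ⟨(hΦd _).comp s hℓm, ?_⟩
  have hcomp := mfderiv_comp s (hΦd (x + s • v)) hℓm
  have h3 : mfderiv 𝓘(ℝ, ℝ) (𝓡 4) ((fun y : E4 ↦ Ψ ⟨y, trivial⟩) ∘ fun s : ℝ ↦ x + s • v) s 1 =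
      mfderiv 𝓘(ℝ, E4) (𝓡 4) (fun y : E4 ↦ Ψ ⟨y, trivial⟩) (x + s • v)
        (mfderiv 𝓘(ℝ, ℝ) 𝓘(ℝ, E4) (fun s : ℝ ↦ x + s • v) s 1) :=
    DFunLike.congr_fun hcomp 1
  have h4 : mfderiv 𝓘(ℝ, E4) (𝓡 4) (fun y : E4 ↦ Ψ ⟨y, trivial⟩) (x + s • v) v =
      mfderiv 𝓘(ℝ, E4) (𝓡 4) Ψ ⟨x + s • v, trivial⟩ v :=
    (DFunLike.congr_fun (mfderiv_comp_subtypeVal' (I' := 𝓘(ℝ, E4)) (I := 𝓡 4)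
      (W := Minkowski.background.domain) (fun y : E4 ↦ Ψ ⟨y, trivial⟩)
      ⟨x + s • v, trivial⟩) v).symm
  exact h3.trans ((DFunLike.congr_arg (mfderiv 𝓘(ℝ, E4) (𝓡 4) (fun y : E4 ↦ Ψ ⟨y, trivial⟩)
    (x + s • v)) hvel).trans h4)

/-- A chart line is `C¹` (`Ψ` read on `E4` is smooth, Lee 2013, Prop. 3.9; lines are smooth). -/
theorem soloBlind_contMDiff_lineCurve {Ψ : Minkowski.background.domain → 𝓢.carrier}
    (hΨ : ContMDiff 𝓘(ℝ, E4) (𝓡 4) ∞ Ψ) (x v : E4) :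
    ContMDiff 𝓘(ℝ, ℝ) (𝓡 4) 1 (soloBlindLineCurve Ψ x v) := by
  have hΦ : ContMDiff 𝓘(ℝ, E4) (𝓡 4) ∞ (fun y : E4 ↦ Ψ ⟨y, trivial⟩) := fun y ↦
    (contMDiffAt_subtype_iff (U := Minkowski.background.domain)
      (f := fun y : E4 ↦ Ψ ⟨y, trivial⟩) (x := ⟨y, trivial⟩)).mp (hΨ ⟨y, trivial⟩)
  have hℓ : ContMDiff 𝓘(ℝ, ℝ) 𝓘(ℝ, E4) ∞ (fun s : ℝ ↦ x + s • v) :=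
    (contDiff_const.add (contDiff_id.smul contDiff_const)).contMDiff
  exact (hΦ.comp hℓ).of_le (by exact_mod_cast le_top)

/-! ### Order-zero extraction on the flat background and the late cones -/

/-- Pointwise form of `deviationCk ≤ Λ` on the flat background: on the slab through `x`,
`|g(dΨ v, dΨ w) − η(v, w)| ≤ Λ ‖v‖ ‖w‖` (Christodoulou–Klainerman 1993, Thm. 1.0.2, the
deviation `g − η`; order-zero extraction `Spacetime.norm_deviation_le_of_deviationCk_le`). -/
theorem soloBlind_abs_pullback_sub_bilin_le (Ψ : Minkowski.background.domain → 𝓢.carrier)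
    (k : ℕ) {Λ : ℝ} (hΛ : 0 ≤ Λ) {x : Minkowski.background.domain}
    (h : 𝓢.deviationCk Minkowski.background Ψ k (x.1 0) ≤ ENNReal.ofReal Λ) (v w : E4) :
    |𝓢.metric.val (Ψ x) (mfderiv 𝓘(ℝ, E4) (𝓡 4) Ψ x v) (mfderiv 𝓘(ℝ, E4) (𝓡 4) Ψ x w) -
        Minkowski.bilin v w| ≤ Λ * ‖v‖ * ‖w‖ := by
  have hx : x ∈ Minkowski.background.timeSlab (x.1 0) := ModelBackground.mem_timeSlab.mpr rfl
  have hdev := 𝓢.norm_deviation_le_of_deviationCk_le Minkowski.background Ψ k hΛ h hx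
  have happ : 𝓢.deviation Minkowski.background Ψ x v w =
      𝓢.metric.val (Ψ x) (mfderiv 𝓘(ℝ, E4) (𝓡 4) Ψ x v) (mfderiv 𝓘(ℝ, E4) (𝓡 4) Ψ x w) -
        Minkowski.bilin v w := by
    rw [Spacetime.deviation_apply]; rfl
  rw [← happ, ← Real.norm_eq_abs]
  calc ‖𝓢.deviation Minkowski.background Ψ x v w‖
      ≤ ‖𝓢.deviation Minkowski.background Ψ x v‖ * ‖w‖ := ContinuousLinearMap.le_opNorm _ _
    _ ≤ ‖𝓢.deviation Minkowski.background Ψ x‖ * ‖v‖ * ‖w‖ := by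
        gcongr; exact ContinuousLinearMap.le_opNorm _ _
    _ ≤ Λ * ‖v‖ * ‖w‖ := by gcongr

/-- **The late cones.** If the deviation on the slab through `x` is at most `1/10`, then for
every direction `v`, `v⁰ = 1`, `‖v − ∂₀‖ ≤ 1/10`, the vector `dΨ_x(v)` is timelike and in the
timecone of `dΨ_x(∂₀)` (`η(∂₀, v) = −1`, `η(v, v) = −1 + ‖v − ∂₀‖²`, errors `≤ ‖v‖²/10`).
O'Neill 1983, Ch. 5, Lemma 5.26 (timecones). -/
theorem soloBlind_cone_of_deviationCk_le {Ψ : Minkowski.background.domain → 𝓢.carrier}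
    (k : ℕ) {x : Minkowski.background.domain}
    (h : 𝓢.deviationCk Minkowski.background Ψ k (x.1 0) ≤ ENNReal.ofReal (1 / 10)) {v : E4}
    (hv0 : v 0 = 1) (hv : ‖v - E4.basisVector 0‖ ≤ 1 / 10) :
    𝓢.metric.IsTimelike (mfderiv 𝓘(ℝ, E4) (𝓡 4) Ψ x v) ∧
      𝓢.metric.val (Ψ x) (mfderiv 𝓘(ℝ, E4) (𝓡 4) Ψ x (E4.basisVector 0))
        (mfderiv 𝓘(ℝ, E4) (𝓡 4) Ψ x v) < 0 := by
  set w : E4 := v - E4.basisVector 0 with hw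
  have hvw : v = E4.basisVector 0 + w := by rw [hw]; abel
  have hw0 : w 0 = 0 := by simp [hw, hv0]
  have hn0 : ‖E4.basisVector 0‖ = 1 := by
    rw [E4.basisVector, EuclideanSpace.single, PiLp.norm_single, norm_one]
  have hnv : ‖v‖ ≤ 11 / 10 := by
    rw [hvw]; exact (norm_add_le _ _).trans (by rw [hn0]; linarith)
  have hη0w : Minkowski.bilin (E4.basisVector 0) w = 0 := by
    rw [Minkowski.bilin_basisVector_zero_left, hw0, neg_zero]
  have hηww : Minkowski.bilin w w = ‖w‖ ^ 2 := by
    rw [Minkowski.bilin_apply, EuclideanSpace.real_norm_sq_eq,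
      Fin.sum_univ_succ (f := fun i => w i ^ 2), hw0]
    simp [sq]
  have hη0v : Minkowski.bilin (E4.basisVector 0) v = -1 := by
    rw [hvw, map_add, Minkowski.bilin_basisVector_zero, hη0w, add_zero]
  have hηvv : Minkowski.bilin v v = -1 + ‖w‖ ^ 2 := by
    rw [hvw, ContinuousLinearMap.map_add₂, map_add, map_add, Minkowski.bilin_basisVector_zero,
      hη0w, Minkowski.bilin_symm w (E4.basisVector 0), hη0w, hηww]
    ring
  have hw2 : ‖w‖ ^ 2 ≤ 1 / 100 := by nlinarith [norm_nonneg w]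
  have h1 := soloBlind_abs_pullback_sub_bilin_le Ψ k (by norm_num : (0 : ℝ) ≤ 1 / 10) h v v
  have h2 := soloBlind_abs_pullback_sub_bilin_le Ψ k (by norm_num : (0 : ℝ) ≤ 1 / 10) h
    (E4.basisVector 0) v
  rw [hηvv] at h1
  rw [hη0v, hn0] at h2
  have hvv : (1 : ℝ) / 10 * ‖v‖ * ‖v‖ ≤ 121 / 1000 := by nlinarith [norm_nonneg v]
  have h0v : (1 : ℝ) / 10 * 1 * ‖v‖ ≤ 11 / 100 := by nlinarith [norm_nonneg v]
  constructor
  · rw [LorentzianMetric.isTimelike_iff]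
    linarith [(abs_le.mp (h1.trans hvv)).2]
  · linarith [(abs_le.mp (h2.trans h0v)).2]

/-- Two timelike vectors in one timecone (`g(a, b) < 0`) are simultaneously future-directed
(O'Neill 1983, Ch. 5, Lemma 5.26 and p. 145). -/
theorem soloBlind_isFutureDirected_iff_of_val_lt_zero {x : 𝓢.carrier}
    {a b : TangentSpace (𝓡 4) x} (ha : 𝓢.metric.IsTimelike a) (hb : 𝓢.metric.IsTimelike b)
    (hab : 𝓢.metric.val x a b < 0) :
    𝓢.timeOrientation.IsFutureDirected a ↔ 𝓢.timeOrientation.IsFutureDirected b :=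
  ⟨fun h ↦ 𝓢.timeOrientation.isFutureDirected_of_val_lt_zero h ha hb.isCausal hab,
    fun h ↦ 𝓢.timeOrientation.isFutureDirected_of_val_lt_zero h hb ha.isCausal
      (by rw [𝓢.metric.symm]; exact hab)⟩

/-! ### Sign constancy along late chart segments -/

/-- **Sign constancy along a late chart segment.** Under `deviationCk ≤ 1/10` beyond chart time
`τ₁`, for `x⁰ ≥ τ₁` and a direction `v`, `v⁰ = 1`, `‖v − ∂₀‖ ≤ 1/10`, the vector `dΨ(v)` is
future-directed at `x` iff at `x + S v` (`S ≥ 0`): `s ↦ g(T, dΨ_{x + s v} v)` is continuous on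
`[0, S]` and never zero (O'Neill 1983, Lemma 5.26), so it keeps its sign (IVT). -/
theorem soloBlind_isFutureDirected_iff_along_line {Ψ : Minkowski.background.domain → 𝓢.carrier}
    (hΨ : ContMDiff 𝓘(ℝ, E4) (𝓡 4) ∞ Ψ) (k : ℕ) {τ₁ : ℝ}
    (hdev : ∀ τ, τ₁ ≤ τ →
      𝓢.deviationCk Minkowski.background Ψ k τ ≤ ENNReal.ofReal (1 / 10))
    {x v : E4} (hx : τ₁ ≤ x 0) (hv0 : v 0 = 1) (hv : ‖v - E4.basisVector 0‖ ≤ 1 / 10)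
    {S : ℝ} (hS : 0 ≤ S) :
    𝓢.timeOrientation.IsFutureDirected (mfderiv 𝓘(ℝ, E4) (𝓡 4) Ψ ⟨x, trivial⟩ v) ↔
      𝓢.timeOrientation.IsFutureDirected
        (mfderiv 𝓘(ℝ, E4) (𝓡 4) Ψ ⟨x + S • v, trivial⟩ v) := by
  set c : ℝ → 𝓢.carrier := soloBlindLineCurve Ψ x v with hc
  have hlate : ∀ s : ℝ, 0 ≤ s → τ₁ ≤ (x + s • v) 0 := by
    intro s hs
    rw [show (x + s • v) 0 = x 0 + s by simp [hv0]]
    linarith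
  -- the sign function `f(s) = g(T, c'(s))` is continuous
  set f : ℝ → ℝ := fun s ↦
    𝓢.metric.val (c s) (𝓢.timeOrientation.vectorField (c s)) (velocity (𝓡 4) c s) with hf
  have hc1 : ContMDiff 𝓘(ℝ, ℝ) (𝓡 4) 1 c := soloBlind_contMDiff_lineCurve hΨ x v
  have hT : Continuous (fun t ↦
      (⟨c t, 𝓢.timeOrientation.vectorField (c t)⟩ : TangentBundle (𝓡 4) 𝓢.carrier)) :=
    (contMDiff_zero_iff.mp (𝓢.timeOrientation.contMDiff.of_le bot_le)).comp hc1.continuous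
  have hfc : Continuous f :=
    𝓢.metric.continuous_val_of_continuous hc1.continuous hT
      (LorentzianMetric.continuous_tangentLift hc1)
  -- for `s ≥ 0` the velocity is `dΨ(v)` at a late point, hence timelike, so `f s ≠ 0`
  have hvel : ∀ s : ℝ, velocity (𝓡 4) c s = mfderiv 𝓘(ℝ, E4) (𝓡 4) Ψ ⟨x + s • v, trivial⟩ v :=
    fun s ↦ (soloBlind_velocity_lineCurve hΨ x v s).2
  have htl : ∀ s : ℝ, 0 ≤ s → 𝓢.metric.IsTimelike (velocity (𝓡 4) c s) := by
    intro s hs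
    rw [hvel s]
    exact (soloBlind_cone_of_deviationCk_le k (x := ⟨x + s • v, trivial⟩)
      (hdev _ (hlate s hs)) hv0 hv).1
  have hne : ∀ s : ℝ, 0 ≤ s → f s ≠ 0 := fun s hs ↦
    𝓢.metric.val_ne_zero_of_isTimelike_of_isCausal (𝓢.timeOrientation.isTimelike _)
      (htl s hs).isCausal
  have hpt : ∀ s : ℝ, 0 ≤ s → ∀ y : E4, y = x + s • v →
      (𝓢.timeOrientation.IsFutureDirected (mfderiv 𝓘(ℝ, E4) (𝓡 4) Ψ ⟨y, trivial⟩ v) ↔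
        f s < 0) := by
    rintro s hs y rfl
    change _ ↔ 𝓢.metric.val (c s) (𝓢.timeOrientation.vectorField (c s)) (velocity (𝓡 4) c s) < 0
    rw [hvel s]
    exact ⟨fun h ↦ h.2, fun h ↦ ⟨(htl s hs |>.isCausal |> fun h' ↦ by rwa [hvel s] at h'), h⟩⟩
  -- intermediate value theorem on `[0, S]`
  have key : f 0 < 0 ↔ f S < 0 := by
    have hcont : ContinuousOn f (Icc 0 S) := hfc.continuousOn
    constructor
    · intro h0
      by_contra hS'
      have hS'' : 0 < f S := lt_of_le_of_ne (not_lt.mp hS') (hne S hS).symm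
      obtain ⟨s, hs, hfs⟩ := intermediate_value_Icc hS hcont ⟨h0.le, hS''.le⟩
      exact hne s hs.1 hfs
    · intro hS'
      by_contra h0
      have h0' : 0 < f 0 := lt_of_le_of_ne (not_lt.mp h0) (hne 0 le_rfl).symm
      obtain ⟨s, hs, hfs⟩ := intermediate_value_Icc' hS hcont ⟨hS'.le, h0'.le⟩
      exact hne s hs.1 hfs
  exact (hpt 0 le_rfl x (by simp)).trans (key.trans (hpt S hS (x + S • v) rfl).symm)

/-- **Any two late chart points carry the same orientation of `dΨ(∂₀)`.** For `y⁰, z⁰ ≥ τ₁`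
join `y`, `z` to the apex `p = z + s_z ∂₀`, `s_z = |y⁰ − z⁰| + 20‖z − y‖ + 1`, by the segments
from `z` (direction `∂₀`) and from `y` (direction `v = (p − y)/(p⁰ − y⁰)`, `‖v − ∂₀‖ ≤ 1/10`);
along both the orientation of `dΨ`(direction) is constant, and at `y` and `p` the vectors
`dΨ(∂₀)`, `dΨ(v)` share a timecone. O'Neill 1983, Ch. 5, Lemma 5.26, p. 145. -/
theorem soloBlind_isFutureDirected_iff_of_late {Ψ : Minkowski.background.domain → 𝓢.carrier}
    (hΨ : ContMDiff 𝓘(ℝ, E4) (𝓡 4) ∞ Ψ) (k : ℕ) {τ₁ : ℝ}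
    (hdev : ∀ τ, τ₁ ≤ τ →
      𝓢.deviationCk Minkowski.background Ψ k τ ≤ ENNReal.ofReal (1 / 10))
    {y z : E4} (hy : τ₁ ≤ y 0) (hz : τ₁ ≤ z 0) :
    𝓢.timeOrientation.IsFutureDirected
        (mfderiv 𝓘(ℝ, E4) (𝓡 4) Ψ ⟨y, trivial⟩ (E4.basisVector 0)) ↔
      𝓢.timeOrientation.IsFutureDirected
        (mfderiv 𝓘(ℝ, E4) (𝓡 4) Ψ ⟨z, trivial⟩ (E4.basisVector 0)) := by
  have he0 : (E4.basisVector 0 : E4) 0 = 1 := by simp [E4.basisVector]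
  have he : ‖(E4.basisVector 0 : E4) - E4.basisVector 0‖ ≤ 1 / 10 := by simp
  have hn0 : ‖(E4.basisVector 0 : E4)‖ = 1 := by
    rw [E4.basisVector, EuclideanSpace.single, PiLp.norm_single, norm_one]
  -- the apex and the direction from `y`
  set sz : ℝ := |y 0 - z 0| + 20 * ‖z - y‖ + 1 with hsz
  have hsz0 : 0 ≤ sz := by positivity
  set p : E4 := z + sz • E4.basisVector 0 with hp
  have hp0 : p 0 = z 0 + sz := by simp [hp]
  set sy : ℝ := p 0 - y 0 with hsy
  have hsy1 : 20 * ‖z - y‖ + 1 ≤ sy := by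
    rw [hsy, hp0, hsz]; linarith [le_abs_self (y 0 - z 0)]
  have hsy0 : 0 < sy := by linarith [norm_nonneg (z - y)]
  set v : E4 := sy⁻¹ • (p - y) with hv
  have hv0 : v 0 = 1 := by
    simp only [hv, PiLp.smul_apply, PiLp.sub_apply, smul_eq_mul, ← hsy]
    exact inv_mul_cancel₀ hsy0.ne'
  have hvw : v - E4.basisVector 0 = sy⁻¹ • ((z - y) + (y 0 - z 0) • E4.basisVector 0) := by
    have h1 : sy⁻¹ * (y 0 - z 0) = sy⁻¹ * sz - 1 := by
      rw [show y 0 - z 0 = sz - sy by rw [hsy, hp0]; ring, mul_sub, inv_mul_cancel₀ hsy0.ne']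
    calc v - E4.basisVector 0
        = sy⁻¹ • (z - y) + (sy⁻¹ * sz - 1) • E4.basisVector 0 := by rw [hv, hp]; module
      _ = sy⁻¹ • ((z - y) + (y 0 - z 0) • E4.basisVector 0) := by rw [← h1]; module
  have hyz0 : |y 0 - z 0| ≤ ‖z - y‖ := by
    have h := PiLp.norm_apply_le (y - z) 0
    rw [PiLp.sub_apply, Real.norm_eq_abs, ← norm_neg (y - z), neg_sub] at h
    exact h
  have hvn : ‖v - E4.basisVector 0‖ ≤ 1 / 10 := by
    rw [hvw, norm_smul, Real.norm_eq_abs, abs_of_pos (inv_pos.mpr hsy0)]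
    have h2 : ‖(z - y) + (y 0 - z 0) • E4.basisVector 0‖ ≤ 2 * ‖z - y‖ := by
      refine (norm_add_le _ _).trans ?_
      rw [norm_smul, Real.norm_eq_abs, hn0, mul_one]
      linarith
    rw [inv_mul_le_iff₀ hsy0]
    nlinarith [norm_nonneg (z - y)]
  have hapex : y + sy • v = p := by
    rw [hv, smul_smul, mul_inv_cancel₀ hsy0.ne', one_smul]; abel
  -- transport of `IsFutureDirected` between syntactically different names of one chart point
  have hcongr : ∀ (u : E4) (a b : E4), a = b →
      (𝓢.timeOrientation.IsFutureDirected (mfderiv 𝓘(ℝ, E4) (𝓡 4) Ψ ⟨a, trivial⟩ u) ↔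
        𝓢.timeOrientation.IsFutureDirected (mfderiv 𝓘(ℝ, E4) (𝓡 4) Ψ ⟨b, trivial⟩ u)) := by
    rintro u a b rfl; exact Iff.rfl
  have hpl : τ₁ ≤ p 0 := by rw [hp0]; linarith
  obtain ⟨hy0t, -⟩ := soloBlind_cone_of_deviationCk_le k (x := ⟨y, trivial⟩) (hdev _ hy) he0 he
  obtain ⟨hyvt, hyv⟩ := soloBlind_cone_of_deviationCk_le k (x := ⟨y, trivial⟩) (hdev _ hy) hv0 hvn
  obtain ⟨hp0t, -⟩ := soloBlind_cone_of_deviationCk_le k (x := ⟨p, trivial⟩) (hdev _ hpl) he0 he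
  obtain ⟨hpvt, hpv⟩ :=
    soloBlind_cone_of_deviationCk_le k (x := ⟨p, trivial⟩) (hdev _ hpl) hv0 hvn
  -- the chain `y ∂₀ ↔ y v ↔ p v ↔ p ∂₀ ↔ z ∂₀`
  have hA := soloBlind_isFutureDirected_iff_of_val_lt_zero hy0t hyvt hyv
  have hB := soloBlind_isFutureDirected_iff_along_line hΨ k hdev hy hv0 hvn hsy0.le
  have hC := (soloBlind_isFutureDirected_iff_of_val_lt_zero hp0t hpvt hpv).symm
  have hD := (soloBlind_isFutureDirected_iff_along_line hΨ k hdev hz he0 he hsz0).symm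
  exact hA.trans ((hB.trans (hcongr v _ _ hapex)).trans (hC.trans hD))

/-! ### The dichotomy -/

/-- **Oriented beyond chart time `τ₁`**: `dΨ(∂₀)` is future-directed timelike at every chart
point with `x⁰ ≥ τ₁` (literally hypothesis (d) of the seat's tied flat chart at `τ₁ = τ₀`). -/
def SoloBlindOrientedBeyond (Ψ : Minkowski.background.domain → 𝓢.carrier) (τ₁ : ℝ) : Prop :=
  ∀ y : Minkowski.background.domain, τ₁ ≤ y.1 0 →
    𝓢.metric.IsTimelike (mfderiv 𝓘(ℝ, E4) (𝓡 4) Ψ y (E4.basisVector 0)) ∧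
      𝓢.timeOrientation.IsFutureDirected (mfderiv 𝓘(ℝ, E4) (𝓡 4) Ψ y (E4.basisVector 0))

/-- **Anti-oriented beyond chart time `τ₁`**: `dΨ(∂₀)` is past-directed timelike at every chart
point with `x⁰ ≥ τ₁` (the chart time runs backwards with respect to `T`). -/
def SoloBlindAntiOrientedBeyond (Ψ : Minkowski.background.domain → 𝓢.carrier) (τ₁ : ℝ) :
    Prop :=
  ∀ y : Minkowski.background.domain, τ₁ ≤ y.1 0 →
    𝓢.metric.IsTimelike (mfderiv 𝓘(ℝ, E4) (𝓡 4) Ψ y (E4.basisVector 0)) ∧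
      𝓢.timeOrientation.IsPastDirected (mfderiv 𝓘(ℝ, E4) (𝓡 4) Ψ y (E4.basisVector 0))

/-- **Eventual time-orientation dichotomy.** If `Ψ` is smooth and its `Cᵏ` deviation from the
flat background on the slabs `{x⁰ = τ}`, `τ ≥ τ₁`, is at most `1/10`, then `dΨ(∂₀)` is timelike
at every chart point with `x⁰ ≥ τ₁`, and it is EITHER future-directed at all of them OR
past-directed at all of them. (No causality or connectedness assumption on the spacetime.)
O'Neill 1983, Ch. 5, Lemma 5.26, p. 145; Christodoulou–Klainerman 1993, Thm. 1.0.2. -/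
theorem soloBlind_orientation_dichotomy {Ψ : Minkowski.background.domain → 𝓢.carrier}
    (hΨ : ContMDiff 𝓘(ℝ, E4) (𝓡 4) ∞ Ψ) (k : ℕ) {τ₁ : ℝ}
    (hdev : ∀ τ, τ₁ ≤ τ →
      𝓢.deviationCk Minkowski.background Ψ k τ ≤ ENNReal.ofReal (1 / 10)) :
    SoloBlindOrientedBeyond Ψ τ₁ ∨ SoloBlindAntiOrientedBeyond Ψ τ₁ := by
  have he0 : (E4.basisVector 0 : E4) 0 = 1 := by simp [E4.basisVector]
  have he : ‖(E4.basisVector 0 : E4) - E4.basisVector 0‖ ≤ 1 / 10 := by simp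
  have htl : ∀ y : Minkowski.background.domain, τ₁ ≤ y.1 0 →
      𝓢.metric.IsTimelike (mfderiv 𝓘(ℝ, E4) (𝓡 4) Ψ y (E4.basisVector 0)) := fun y hy ↦
    (soloBlind_cone_of_deviationCk_le k (x := y) (hdev _ hy) he0 he).1
  by_cases h : ∃ y : Minkowski.background.domain, τ₁ ≤ y.1 0 ∧
      𝓢.timeOrientation.IsFutureDirected (mfderiv 𝓘(ℝ, E4) (𝓡 4) Ψ y (E4.basisVector 0))
  · obtain ⟨y, hy, hyf⟩ := h
    refine Or.inl fun z hz ↦ ⟨htl z hz, ?_⟩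
    exact (soloBlind_isFutureDirected_iff_of_late hΨ k hdev (y := y.1) (z := z.1) hy hz).mp hyf
  · refine Or.inr fun z hz ↦ ⟨htl z hz, ?_⟩
    rcases 𝓢.timeOrientation.isFutureDirected_or_isPastDirected_of_isCausal (htl z hz).isCausal
      with hf | hp
    · exact absurd ⟨z, hz, hf⟩ h
    · exact hp

/-- **The second branch is all that (d) has to exclude**: under the same smallness, ONE chart
point with `x⁰ ≥ τ₁` at which `dΨ(∂₀)` is not past-directed makes `Ψ` oriented beyond `τ₁`.
O'Neill 1983, Ch. 5, Lemma 5.26. -/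
theorem soloBlind_orientedBeyond_of_not_isPastDirected
    {Ψ : Minkowski.background.domain → 𝓢.carrier} (hΨ : ContMDiff 𝓘(ℝ, E4) (𝓡 4) ∞ Ψ) (k : ℕ)
    {τ₁ : ℝ} (hdev : ∀ τ, τ₁ ≤ τ →
      𝓢.deviationCk Minkowski.background Ψ k τ ≤ ENNReal.ofReal (1 / 10))
    {y : Minkowski.background.domain} (hy : τ₁ ≤ y.1 0)
    (hny : ¬ 𝓢.timeOrientation.IsPastDirected (mfderiv 𝓘(ℝ, E4) (𝓡 4) Ψ y (E4.basisVector 0))) :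
    SoloBlindOrientedBeyond Ψ τ₁ := by
  rcases soloBlind_orientation_dichotomy hΨ k hdev with h | h
  · exact h
  · exact absurd (h y hy).2 hny

/-- **Asymptotic form.** If the `Cᵏ` deviation from the flat background tends to `0` along the
slabs (the convergence clause of `Spacetime.ConvergesToMinkowski`), the dichotomy holds beyond
some chart time `τ₁`. Christodoulou–Klainerman 1993, Thm. 1.0.2; O'Neill 1983, Lemma 5.26. -/
theorem soloBlind_eventually_oriented_of_tendsto {Ψ : Minkowski.background.domain → 𝓢.carrier}
    (hΨ : ContMDiff 𝓘(ℝ, E4) (𝓡 4) ∞ Ψ) {k : ℕ}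
    (hdev : Tendsto (fun τ ↦ 𝓢.deviationCk Minkowski.background Ψ k τ) atTop (𝓝 0)) :
    ∃ τ₁ : ℝ, SoloBlindOrientedBeyond Ψ τ₁ ∨ SoloBlindAntiOrientedBeyond Ψ τ₁ := by
  have hpos : (0 : ℝ≥0∞) < ENNReal.ofReal (1 / 10) := ENNReal.ofReal_pos.mpr (by norm_num)
  obtain ⟨τ₁, hτ₁⟩ := eventually_atTop.mp ((tendsto_order.1 hdev).2 _ hpos)
  exact ⟨τ₁, soloBlind_orientation_dichotomy hΨ k fun τ hτ ↦ (hτ₁ τ hτ).le⟩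

end Summit.FinalStateConjecture.FinalStateConjecture.Theorems

end
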